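import Literature.Analysis.UnboundedOperators.StrongContRepresentationDerivProofs
import Literature.Analysis.UnboundedOperators.RankOneMildRenewal
import Literature.Analysis.Complex.LaplaceHalfLine
import HarnessLib

/-!
# The renewal kernel `k(t) = ℓ(S(t)f)` of a rank-one feedback is `C¹` with exponentially decaying derivative when `f ∈ D(A)`

Topic `Literature/Analysis/UnboundedOperators`. Everything PROVED (Engel–Nagel II Lemma 1.3 (ii): orbits of domain elements are
differentiable with `d/dt S(t)f = S(t)Af`; I Prop. 5.5: growth bound).

For a C₀-semigroup `S` on a Banach space with `‖S(t)‖ ≤ e^{−μt}`, a functional `ℓ ∈ X*` and `f ∈ D(A)` (`A = S.generator`):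
* `halfLineExpBound_apply_app` — `t ↦ ℓ(S(t⁺)x)` is continuous on `ℝ` with `‖ℓ(S(t⁺)x)‖ ≤ ‖ℓ‖‖x‖e^{−μt}` on `t ≥ 0`
  (`Literature.Analysis.Complex.HalfLineExpBound`, the hypothesis structure of the half-line Laplace files);
* `hasDerivAt_apply_app` — for `t > 0`, `d/dt ℓ(S(t⁺)f) = ℓ(S(t⁺)Af)`;
* `renewalKernel_fields` — the three `k`-fields of `Literature.Analysis.Convolution.RenewalPoleData` for `k = ℓ(S(·⁺)f)`,
  `k′ = ℓ(S(·⁺)Af)`, with the common constant `K = ‖ℓ‖·max(‖f‖, ‖Af‖)` and rate `−μ`.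

USE: discharges composer note (r1) of the ns-blowup renewal route ((R-c) needs `k ∈ C¹` with `‖k‖, ‖k′‖ ≤ Ke^{−μt}`): the only
model-specific input left is `f ∈ D(A)`. NOT here: anything about a specific model.
-/

noncomputable section

open _root_.Set _root_.Filter _root_.Real NNReal
open scoped _root_.Topology
open Literature.Analysis.Complex

namespace Literature.Analysis.UnboundedOperators

namespace C0Semigroup

variable {X : Type*} [NormedAddCommGroup X] [NormedSpace ℂ X]
variable (S : C0Semigroup ℂ X) (ℓ : X →L[ℂ] ℂ)

/-- **The scalar orbit `t ↦ ℓ(S(t⁺)x)` is continuous of exponential order `−μ`** with constant `‖ℓ‖‖x‖`, in the sense of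
`HalfLineExpBound`, for any constant `G ≥ ‖ℓ‖‖x‖`. [cite: EngelNagel2000, Ch. I Prop. 5.5] -/
theorem halfLineExpBound_apply_app {μ : ℝ} (hS : ∀ t : ℝ≥0, ‖S.app t‖ ≤ Real.exp (-μ * t)) (x : X) {G : ℝ}
    (hG : ‖ℓ‖ * ‖x‖ ≤ G) : HalfLineExpBound (fun t : ℝ => ℓ (S.app (Real.toNNReal t) x)) G (-μ) :=
  ⟨ℓ.continuous.comp (S.continuous_app_toNNReal x), fun _ ht =>
    (norm_apply_app_toNNReal_le (S := S) (ℓ := ℓ) hS x ht).trans (mul_le_mul_of_nonneg_right hG (Real.exp_pos _).le)⟩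

variable [CompleteSpace X]

/-- **Differentiability of the kernel** for `f ∈ D(A)`: `d/dt ℓ(S(t⁺)f) = ℓ(S(t⁺)Af)` at every `t > 0`.
[cite: EngelNagel2000, Ch. II Lemma 1.3 (ii)] -/
theorem hasDerivAt_apply_app (f : S.generator.domain) {t : ℝ} (ht : 0 < t) :
    HasDerivAt (fun s : ℝ => ℓ (S.app (Real.toNNReal s) (f : X)))
      (ℓ (S.app (Real.toNNReal t) (S.generator f))) t := by
  have h := S.hasDerivAt_app_of_mem f (t := Real.toNNReal t) (by simpa using ht)
  rw [Real.coe_toNNReal t ht.le] at h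
  have h2 := (ℓ.restrictScalars ℝ).hasFDerivAt.comp_hasDerivAt t h
  simpa [Function.comp_def] using h2

/-- **The `k`-fields of `RenewalPoleData` for the kernel of a rank-one feedback with `f ∈ D(A)`**: with `k(t) = ℓ(S(t⁺)f)`,
`k′(t) = ℓ(S(t⁺)Af)` and `K = ‖ℓ‖·max(‖f‖, ‖Af‖)`: `HalfLineExpBound k K (−μ)`, `HalfLineExpBound k′ K (−μ)`, and `k′ = dk/dt` on
`(0, ∞)`. [cite: EngelNagel2000, Ch. II Lemma 1.3 (ii) / Ch. I Prop. 5.5] -/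
theorem renewalKernel_fields {μ : ℝ} (hS : ∀ t : ℝ≥0, ‖S.app t‖ ≤ Real.exp (-μ * t)) (f : S.generator.domain) :
    HalfLineExpBound (fun t : ℝ => ℓ (S.app (Real.toNNReal t) (f : X))) (‖ℓ‖ * max ‖(f : X)‖ ‖S.generator f‖) (-μ) ∧
    HalfLineExpBound (fun t : ℝ => ℓ (S.app (Real.toNNReal t) (S.generator f))) (‖ℓ‖ * max ‖(f : X)‖ ‖S.generator f‖) (-μ) ∧
    ∀ t : ℝ, 0 < t → HasDerivAt (fun s : ℝ => ℓ (S.app (Real.toNNReal s) (f : X)))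
      (ℓ (S.app (Real.toNNReal t) (S.generator f))) t :=
  ⟨S.halfLineExpBound_apply_app ℓ hS (f : X) (mul_le_mul_of_nonneg_left (le_max_left _ _) (norm_nonneg _)),
   S.halfLineExpBound_apply_app ℓ hS (S.generator f) (mul_le_mul_of_nonneg_left (le_max_right _ _) (norm_nonneg _)),
   fun _ ht => S.hasDerivAt_apply_app ℓ f ht⟩

end C0Semigroup

end Literature.Analysis.UnboundedOperators
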